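import Mathlib
import HarnessLib

/-!
# Crux K2 `PoloidalWindowRigidity` (stmt-NavierStokesRegularity-19708), line `z_shock` — towards L0(b): PARALLEL GRADIENTS ⇒
# THE SLOPE IS CONSTANT ALONG LEVEL CURVES OF `w`

`--supports stmt-NavierStokesRegularity-19708 --as helper` (leafhand-ns-poloidalwindowdoor-1 g0, 2026-08-30).  Class-free calculus,
Mathlib only.  **No stub and no summit is closed by this file; Navier–Stokes regularity is NOT proved here.**

L0(a) (tree: `…ZShockAutonomyGlobal`) globalises the LOCAL autonomy clause of the deciding stub `stub_zShockThickAut` to the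
pointwise statement «all `2 × 2` minors of `(D_b, ∇w)` vanish on the whole slice».  L0(b) of the card (`Lines/z_shock.md` §«First
lemma of R3»: «`D_b ≡ 0` + `∇ₕw ≠ 0` on a connected open `Ω` ⇒ `∂_z v_b = g̃(w)·∂_b w` on `Ω` whenever the level sets are connected»)
has an analytic kernel and a topological remainder.  This file is the analytic kernel, for real functions on any real normed space:

* `eq_smul_of_minors_eq_zero` — if all `2 × 2` minors of two linear functionals `(A, B)` vanish and `B e ≠ 0`, then
  `A = (A e / B e) • B` (so «minors vanish» ⇔ «`A ∥ B`» wherever `B ≠ 0`);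
* `const_along_level_curve` — if `DΛ(x) = c(x)·Dw(x)` at every point of a differentiable curve `γ : ℝ → E` lying in a level set
  of `w` (`w ∘ γ` constant), then `Λ ∘ γ` is constant: the slope `Λ` is constant on every differentiably path-connected piece of a
  level set.  What remains of L0(b)/(c) is purely topological (patching the values across level-set components).

presearch: functional dependence / constant on level sets — nothing in Mathlib or the tree beyond the companions
`…ZShockSlopeFunctionParallel`, `…ZShockAutonomyGlobal`. [folklore]
-/

noncomputable section

namespace Summit.NavierStokesRegularity.NavierStokesRegularity.Theorems.PoloidalWindowDoorPoloidalWindowRigidityZShockSlopeLevelCurves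

-- the problem directory repeats the summit name (`NavierStokesRegularity/NavierStokesRegularity`)
set_option linter.dupNamespace false

open Set Filter Topology Function

variable {E : Type*} [NormedAddCommGroup E] [NormedSpace ℝ E]

/-- **Vanishing minors ⇒ proportional functionals.**  If `A u · B v = A v · B u` for all `u, v` and `B e ≠ 0`, then
`A = (A e / B e) • B`. [folklore] -/
theorem eq_smul_of_minors_eq_zero {A B : E →L[ℝ] ℝ} {e : E} (he : B e ≠ 0)
    (hminor : ∀ u v : E, A u * B v - A v * B u = 0) : A = (A e / B e) • B := by
  refine ContinuousLinearMap.ext fun u => ?_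
  have h := hminor u e
  simp only [smul_apply, smul_eq_mul]
  field_simp
  linarith

/-- **The slope is constant along level curves.**  Let `Λ, w : E → ℝ` be differentiable at the points of a curve `γ : ℝ → E`
(`γ` differentiable everywhere), with `DΛ(γ t) = c(t)·Dw(γ t)` for every `t` and `w ∘ γ` constant.  Then `Λ ∘ γ` is constant.
Proof: `(Λ∘γ)' = DΛ(γ)[γ'] = c·Dw(γ)[γ'] = c·(w∘γ)' = 0`. [folklore] -/
theorem const_along_level_curve {Λ w : E → ℝ} {γ : ℝ → E} {γ' : ℝ → E} {c : ℝ → ℝ}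
    (hγ : ∀ t, HasDerivAt γ (γ' t) t) (hΛ : ∀ t, DifferentiableAt ℝ Λ (γ t)) (hw : ∀ t, DifferentiableAt ℝ w (γ t))
    (hpar : ∀ t, fderiv ℝ Λ (γ t) = c t • fderiv ℝ w (γ t)) (hlevel : ∀ t, w (γ t) = w (γ 0)) :
    ∀ t, Λ (γ t) = Λ (γ 0) := by
  -- `(w ∘ γ)' = Dw(γ)[γ'] = 0`
  have hwγ : ∀ t, fderiv ℝ w (γ t) (γ' t) = 0 := by
    intro t
    have h1 : HasDerivAt (fun s => w (γ s)) (fderiv ℝ w (γ t) (γ' t)) t :=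
      (hw t).hasFDerivAt.comp_hasDerivAt t (hγ t)
    have h2 : HasDerivAt (fun s => w (γ s)) 0 t := by
      have : (fun s => w (γ s)) = fun _ => w (γ 0) := funext hlevel
      rw [this]; exact hasDerivAt_const t _
    exact h1.unique h2
  -- `(Λ ∘ γ)' = c · (w ∘ γ)' = 0`
  have hΛγ : ∀ t, HasDerivAt (fun s => Λ (γ s)) 0 t := by
    intro t
    have h1 : HasDerivAt (fun s => Λ (γ s)) (fderiv ℝ Λ (γ t) (γ' t)) t :=
      (hΛ t).hasFDerivAt.comp_hasDerivAt t (hγ t)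
    refine h1.congr_deriv ?_
    rw [hpar t, smul_apply, hwγ t, smul_zero]
  intro t
  exact is_const_of_deriv_eq_zero (fun s => (hΛγ s).differentiableAt) (fun s => (hΛγ s).deriv) t 0

/-- **Combined form (the analytic kernel of L0(b)).**  If at every point of a differentiable curve `γ` lying in a level set of `w`
the minors of `(DΛ, Dw)` vanish and `Dw(γ t) e_t ≠ 0` for some direction `e_t`, then `Λ ∘ γ` is constant. [folklore] -/
theorem const_along_level_curve_of_minors {Λ w : E → ℝ} {γ : ℝ → E} {γ' e : ℝ → E}
    (hγ : ∀ t, HasDerivAt γ (γ' t) t) (hΛ : ∀ t, DifferentiableAt ℝ Λ (γ t)) (hw : ∀ t, DifferentiableAt ℝ w (γ t))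
    (he : ∀ t, fderiv ℝ w (γ t) (e t) ≠ 0)
    (hminor : ∀ t, ∀ u v : E, fderiv ℝ Λ (γ t) u * fderiv ℝ w (γ t) v - fderiv ℝ Λ (γ t) v * fderiv ℝ w (γ t) u = 0)
    (hlevel : ∀ t, w (γ t) = w (γ 0)) : ∀ t, Λ (γ t) = Λ (γ 0) :=
  const_along_level_curve hγ hΛ hw (c := fun t => fderiv ℝ Λ (γ t) (e t) / fderiv ℝ w (γ t) (e t))
    (fun t => eq_smul_of_minors_eq_zero (he t) (hminor t)) hlevel

end Summit.NavierStokesRegularity.NavierStokesRegularity.Theorems.PoloidalWindowDoorPoloidalWindowRigidityZShockSlopeLevelCurves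

end
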